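import Mathlib
import Summits.ResolutionOfSingularities.ResolutionOfSingularities.Theorems.WeightedInvariantLocalWeightedDropNCPolyBridgeRepresents
import Summits.ResolutionOfSingularities.ResolutionOfSingularities.Theorems.WeightedInvariantLocalWeightedDropMonicDescentChartSubst
import Summits.ResolutionOfSingularities.ResolutionOfSingularities.Theorems.WeightedInvariantLocalWeightedDropMonicDescentSliceIdentifyTwo
import Summits.ResolutionOfSingularities.ResolutionOfSingularities.Theorems.WeightedInvariantLocalWeightedDropMonicDescentBridgeTools
import Summits.ResolutionOfSingularities.ResolutionOfSingularities.Theorems.WeightedInvariantLocalWeightedDropPolyDescentDefs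

/-!
# TOT2-LINE (P3) brick B5-L: THE FOUR CHART MAPS ON MONIC GERMS

Sub-problem `ResolutionOfSingularities`, ENGINE crux `stmt-ResolutionOfSingularities-8899` (`LocalWeightedDrop`), skeleton v35 (2e806da509994632),
registered stub `stub_conflictBudget` (P3); typed split `L/res-L1-w43-stub-2/g6/P3_split_v1.lean` (7fbb6274b2c57d05), bricks B5-L1 … B5-L4 VERBATIM.
[OURS · L1 W4.3 · chain w43 · res-L1-w43-stub-2 g6 (owner of (P3)); def-free; engine bookkeeping over the tree's chart calculus
(`MonicDescent.X_pow_mul_blowOne/blowTwo/divOne/divTwo`); nothing here is a statement of any manuscript; AI-produced, gate-checked, weaker than expert review.]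

The germ-level form of the four label transports of `PolyDescent`: with `F = NCPoly.monicGerm d A = y^d + Σ A_j(u₁,u₂) y^j` (`y = X 2`),
* `subst_chartOne_monicGerm`   — `F(u₁, u₁u₂, u₁y) = u₁^d · monicGerm d (blowOneT d A)`  (positions),
* `subst_chartTwo_monicGerm`   — `F(u₁u₂, u₂, u₂y) = u₂^d · monicGerm d (blowTwoT d A)`  (positions),
* `subst_chartDivOne_monicGerm` — `F(u₁, u₂, u₁y) = u₁^d · monicGerm d (divOneT d A)`   (`V(y,u₁)` permissible),
* `subst_chartDivTwo_monicGerm` — `F(u₁, u₂, u₂y) = u₂^d · monicGerm d (divTwoT d A)`   (`V(y,u₂)` permissible),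
through the generic `subst_monicGerm_of_slots` (a substitution scaling `y` by `u` and carrying each embedded slot `A_j` to `u^{d−j} ·` the new slot
multiplies the monic germ by `u^d`) and `subst_rename_eq_rename_subst` (a 3-space substitution that restricts to a plane substitution commutes with
the embedding `k⟦u₁,u₂⟧ → k⟦u₁,u₂,y⟧`).
-/

set_option linter.dupNamespace false -- mandated namespace of this single-conjunct summit

noncomputable section

namespace Summit.ResolutionOfSingularities.ResolutionOfSingularities.Theorems

namespace TOT2Branch

open MvPowerSeries PolyDescent MonicDescent

variable {k : Type} [Field k]

/-! ## Generic tools -/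

/-- A substitution of `k⟦u₁,u₂,y⟧` whose plane components are the embedded components of a plane substitution commutes with the embedding
`rename (Fin.succAboveEmb (Fin.last 2))`. -/
theorem subst_rename_eq_rename_subst (c : Fin 3 → MvPowerSeries (Fin 3) k) (hc : ∀ i, constantCoeff (c i) = 0)
    (a : Fin 2 → MvPowerSeries (Fin 2) k) (ha : ∀ i, constantCoeff (a i) = 0)
    (hca : ∀ i : Fin 2, c (Fin.succAboveEmb (Fin.last 2) i) = rename (Fin.succAboveEmb (Fin.last 2)) (a i)) (g : MvPowerSeries (Fin 2) k) :
    subst c (rename (Fin.succAboveEmb (Fin.last 2)) g) = rename (Fin.succAboveEmb (Fin.last 2)) (subst a g) := by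
  have has := hasSubst_of_constantCoeff_zero ha
  rw [subst_rename_eq _ c hc g, rename_eq_subst, subst_comp_subst_apply has (HasSubst.X_comp _)]
  congr 1
  funext i
  rw [hca i, rename_eq_subst]

/-- **A substitution scaling `y` by `u` and the embedded slots by `u^{d−j}` multiplies the monic germ by `u^d`.** -/
theorem subst_monicGerm_of_slots {d : ℕ} (c : Fin 3 → MvPowerSeries (Fin 3) k) (hc : ∀ i, constantCoeff (c i) = 0)
    (u : MvPowerSeries (Fin 3) k) (hlast : c (Fin.last 2) = u * X (Fin.last 2)) (A B : Fin d → MvPowerSeries (Fin 2) k)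
    (hAB : ∀ j : Fin d, subst c (rename (Fin.succAboveEmb (Fin.last 2)) (A j)) = u ^ (d - (j : ℕ)) * rename (Fin.succAboveEmb (Fin.last 2)) (B j)) :
    subst c (NCPoly.monicGerm d A) = u ^ d * NCPoly.monicGerm d B := by
  have hs := hasSubst_of_constantCoeff_zero hc
  have hY : subst c (X (Fin.last 2) : MvPowerSeries (Fin 3) k) = u * X (Fin.last 2) := by rw [subst_X hs, hlast]
  unfold NCPoly.monicGerm
  rw [← coe_substAlgHom hs, map_add, map_pow, map_sum, coe_substAlgHom, hY, mul_add, mul_pow, Finset.mul_sum]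
  congr 1
  refine Finset.sum_congr rfl fun j _ => ?_
  rw [← coe_substAlgHom hs, map_mul, map_pow, coe_substAlgHom, hAB j, hY, mul_pow]
  have hjd : (j : ℕ) ≤ d := j.2.le
  have hu : u ^ (d - (j : ℕ)) * u ^ (j : ℕ) = u ^ d := by rw [← pow_add, Nat.sub_add_cancel hjd]
  calc u ^ (d - (j : ℕ)) * rename (Fin.succAboveEmb (Fin.last 2)) (B j) * (u ^ (j : ℕ) * X (Fin.last 2) ^ (j : ℕ))
      = (u ^ (d - (j : ℕ)) * u ^ (j : ℕ)) * (rename (Fin.succAboveEmb (Fin.last 2)) (B j) * X (Fin.last 2) ^ (j : ℕ)) := by ring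
    _ = u ^ d * (rename (Fin.succAboveEmb (Fin.last 2)) (B j) * X (Fin.last 2) ^ (j : ℕ)) := by rw [hu]

/-- Exponent bound of a position slot: every exponent `e` of `A_j` has `e₀ + e₁ ≥ d − j` (indeed `>`). -/
theorem le_add_of_isPosT {d : ℕ} {A : Fin d → MvPowerSeries (Fin 2) k} (hA : IsPosT d A) (j : Fin d) (e : Fin 2 →₀ ℕ)
    (he : coeff e (A j) ≠ 0) : d - (j : ℕ) ≤ e 0 + e 1 := by
  have h1 : (A j).order ≤ (e.degree : ℕ∞) := MvPowerSeries.order_le (by simpa using he)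
  have h2 := lt_of_lt_of_le (hA j) h1
  have hdeg : e.degree = e 0 + e 1 := by rw [Finsupp.degree_eq_sum]; simp [Fin.sum_univ_two]
  rw [hdeg] at h2
  exact (by exact_mod_cast h2 : d - (j : ℕ) < e 0 + e 1).le

/-- The plane embedding on indices: `succAbove 2 1 = 1` in `Fin 3`. -/
theorem succAbove_two_one : Fin.succAbove (2 : Fin 3) (1 : Fin 2) = 1 := by decide


/-! ## The four charts -/

/-- **B5-L1: the `u₁`-chart on monic germs** (positions). -/
theorem subst_chartOne_monicGerm {d : ℕ} (A : Fin d → MvPowerSeries (Fin 2) k) (hA : IsPosT d A) :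
    subst (![X 0, X 0 * X 1, X 0 * X 2] : Fin 3 → MvPowerSeries (Fin 3) k) (NCPoly.monicGerm d A) =
      X 0 ^ d * NCPoly.monicGerm d (blowOneT d A) := by
  have hc : ∀ i, constantCoeff ((![X 0, X 0 * X 1, X 0 * X 2] : Fin 3 → MvPowerSeries (Fin 3) k) i) = 0 := by
    intro i; fin_cases i <;> simp
  have ha : ∀ i, constantCoeff ((![X 0, X 0 * X 1] : Fin 2 → MvPowerSeries (Fin 2) k) i) = 0 := by
    intro i; fin_cases i <;> simp
  refine subst_monicGerm_of_slots _ hc (X 0) rfl A (blowOneT d A) fun j => ?_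
  have hca : ∀ i : Fin 2, (![X 0, X 0 * X 1, X 0 * X 2] : Fin 3 → MvPowerSeries (Fin 3) k) (Fin.succAboveEmb (Fin.last 2) i) =
      rename (Fin.succAboveEmb (Fin.last 2)) ((![X 0, X 0 * X 1] : Fin 2 → MvPowerSeries (Fin 2) k) i) := by
    intro i
    fin_cases i
    · simp [rename_X]
    · simp [rename_X, map_mul, succAbove_two_one]
  rw [subst_rename_eq_rename_subst _ hc _ ha hca, ← X_pow_mul_blowOne (d - (j : ℕ)) (A j) (le_add_of_isPosT hA j), map_mul, map_pow, rename_X]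
  rfl

/-- **B5-L2: the `u₂`-chart on monic germs** (positions). -/
theorem subst_chartTwo_monicGerm {d : ℕ} (A : Fin d → MvPowerSeries (Fin 2) k) (hA : IsPosT d A) :
    subst (![X 0 * X 1, X 1, X 1 * X 2] : Fin 3 → MvPowerSeries (Fin 3) k) (NCPoly.monicGerm d A) =
      X 1 ^ d * NCPoly.monicGerm d (blowTwoT d A) := by
  have hc : ∀ i, constantCoeff ((![X 0 * X 1, X 1, X 1 * X 2] : Fin 3 → MvPowerSeries (Fin 3) k) i) = 0 := by
    intro i; fin_cases i <;> simp
  have ha : ∀ i, constantCoeff ((![X 0 * X 1, X 1] : Fin 2 → MvPowerSeries (Fin 2) k) i) = 0 := by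
    intro i; fin_cases i <;> simp
  refine subst_monicGerm_of_slots _ hc (X 1) rfl A (blowTwoT d A) fun j => ?_
  have hca : ∀ i : Fin 2, (![X 0 * X 1, X 1, X 1 * X 2] : Fin 3 → MvPowerSeries (Fin 3) k) (Fin.succAboveEmb (Fin.last 2) i) =
      rename (Fin.succAboveEmb (Fin.last 2)) ((![X 0 * X 1, X 1] : Fin 2 → MvPowerSeries (Fin 2) k) i) := by
    intro i
    fin_cases i
    · simp [rename_X, map_mul, succAbove_two_one]
    · simp [rename_X, succAbove_two_one]
  rw [subst_rename_eq_rename_subst _ hc _ ha hca, ← X_pow_mul_blowTwo (d - (j : ℕ)) (A j) (le_add_of_isPosT hA j), map_mul, map_pow, rename_X]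
  rfl

/-- **B5-L3: the `V(y,u₁)`-chart on monic germs** (`V(y,u₁)` permissible). -/
theorem subst_chartDivOne_monicGerm {d : ℕ} (A : Fin d → MvPowerSeries (Fin 2) k) (hA : IsPermissibleOneT d A) :
    subst (![X 0, X 1, X 0 * X 2] : Fin 3 → MvPowerSeries (Fin 3) k) (NCPoly.monicGerm d A) =
      X 0 ^ d * NCPoly.monicGerm d (divOneT d A) := by
  have hc : ∀ i, constantCoeff ((![X 0, X 1, X 0 * X 2] : Fin 3 → MvPowerSeries (Fin 3) k) i) = 0 := by
    intro i; fin_cases i <;> simp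
  have ha : ∀ i, constantCoeff ((![X 0, X 1] : Fin 2 → MvPowerSeries (Fin 2) k) i) = 0 := by
    intro i; fin_cases i <;> simp
  refine subst_monicGerm_of_slots _ hc (X 0) rfl A (divOneT d A) fun j => ?_
  have hca : ∀ i : Fin 2, (![X 0, X 1, X 0 * X 2] : Fin 3 → MvPowerSeries (Fin 3) k) (Fin.succAboveEmb (Fin.last 2) i) =
      rename (Fin.succAboveEmb (Fin.last 2)) ((![X 0, X 1] : Fin 2 → MvPowerSeries (Fin 2) k) i) := by
    intro i
    fin_cases i
    · simp [rename_X]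
    · simp [rename_X, succAbove_two_one]
  have hid : subst (![X 0, X 1] : Fin 2 → MvPowerSeries (Fin 2) k) (A j) = A j := by
    have : (![X 0, X 1] : Fin 2 → MvPowerSeries (Fin 2) k) = X := by funext i; fin_cases i <;> rfl
    rw [this, subst_self]; rfl
  rw [subst_rename_eq_rename_subst _ hc _ ha hca, hid, ← X_pow_mul_divOne (d - (j : ℕ)) (A j) (fun e he => hA j e he), map_mul, map_pow,
    rename_X]
  rfl

/-- **B5-L4: the `V(y,u₂)`-chart on monic germs** (`V(y,u₂)` permissible). -/
theorem subst_chartDivTwo_monicGerm {d : ℕ} (A : Fin d → MvPowerSeries (Fin 2) k) (hA : IsPermissibleTwoT d A) :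
    subst (![X 0, X 1, X 1 * X 2] : Fin 3 → MvPowerSeries (Fin 3) k) (NCPoly.monicGerm d A) =
      X 1 ^ d * NCPoly.monicGerm d (divTwoT d A) := by
  have hc : ∀ i, constantCoeff ((![X 0, X 1, X 1 * X 2] : Fin 3 → MvPowerSeries (Fin 3) k) i) = 0 := by
    intro i; fin_cases i <;> simp
  have ha : ∀ i, constantCoeff ((![X 0, X 1] : Fin 2 → MvPowerSeries (Fin 2) k) i) = 0 := by
    intro i; fin_cases i <;> simp
  refine subst_monicGerm_of_slots _ hc (X 1) rfl A (divTwoT d A) fun j => ?_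
  have hca : ∀ i : Fin 2, (![X 0, X 1, X 1 * X 2] : Fin 3 → MvPowerSeries (Fin 3) k) (Fin.succAboveEmb (Fin.last 2) i) =
      rename (Fin.succAboveEmb (Fin.last 2)) ((![X 0, X 1] : Fin 2 → MvPowerSeries (Fin 2) k) i) := by
    intro i
    fin_cases i
    · simp [rename_X]
    · simp [rename_X, succAbove_two_one]
  have hid : subst (![X 0, X 1] : Fin 2 → MvPowerSeries (Fin 2) k) (A j) = A j := by
    have : (![X 0, X 1] : Fin 2 → MvPowerSeries (Fin 2) k) = X := by funext i; fin_cases i <;> rfl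
    rw [this, subst_self]; rfl
  rw [subst_rename_eq_rename_subst _ hc _ ha hca, hid, ← X_pow_mul_divTwo (d - (j : ℕ)) (A j) (fun e he => hA j e he), map_mul, map_pow,
    rename_X]
  rfl

end TOT2Branch

end Summit.ResolutionOfSingularities.ResolutionOfSingularities.Theorems

end
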